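/-
Copyright: the b2b-balaban T⁴-continuum CRUX team, row NE7b leaf lineage `t4-ne7b-formalise-leaf-03` (gen 149; v1.3 docstrings gen 150). Project licence.
-/
import Summits.QuantumFields.BalabanUV.T4Continuum.Spine.NE7b.HardStepKKTBranch
import Summits.QuantumFields.BalabanUV.T4Continuum.Spine.NE7b.KKTChartDerivativeModulus
import Summits.QuantumFields.BalabanUV.T4Continuum.Spine.NE7b.HardStepKKTActionHessian
import Summits.QuantumFields.BalabanUV.T4Continuum.Spine.NE7b.TransportedFormCoercivity
import Mathlib.Analysis.Calculus.Deriv.Mul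

/-!
# ONE INDUCTIVE STEP OF THE NONLINEAR-CONSTRAINT (KKT) HARD-STEP ROAD, AS ONE THEOREM — the scale-`k` letters at a KKT base pair
# `(δ₀, λ₀)` (`T = DG(δ₀)` with a right inverse, kernel coercivity `m` of the LAGRANGIAN form `D²V(δ₀) − λ₀ ∘ D²G(δ₀)` on `ker T`,
# the Neumann margin `c < N′⁻¹`, the primal–dual ball letters) give the branch `σ = (δ, λ)`, the next action `V⁺ = V ∘ δ` with
# `DV⁺ = λ`, its Hessian letters with explicit constants, criticality at the next centre when `λ₀ = 0`, and the next kernel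
# coercivity from a two-scale letter — every parent BY NAME: HKB → KCDM → HKAH → TFC (row NE7b, node U5c; assembly, [folklore];
# the KKT twin of leaf-06's `…HardStepInductiveStep` (HSIS))

Cell `pub-balaban`, sub-cell `t4`, spine estimate NE7b (`T4WeightBudget.RelWeightBound`; the cell's OWN estimate — NOT PRINTED
in [Bałaban 1983–89], NOT PROVED).  Crux-route work under `Spine/NE7b/` by leaf-03 (CRUX team (2), FREEZE (0) crux-prover clause).
NOTHING of Bałaban's is named, asserted, valued or discharged; no `T4Continuum/Support` leaf typed; no `def`; zero `sorry`.  ASSEMBLY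
ONLY over four tree files BY NAME: this lineage's `…HardStepKKTBranch` (HKB: the KKT branch on the ball of radius `(N′⁻¹ − c)r`,
Lipschitz `(N′⁻¹ − c)⁻¹`, `C¹` with `σ′(w) = A_w⁻¹ ∘ inl` — itself ALE → KCD → HSCR → HSBD), `…KKTChartDerivativeModulus` (KCDM: the
modulus of `σ′`, via leaf-04's HSBDM), leaf-04's `…HardStepKKTActionHessian` (HKAH: `DV⁺ = λ`, `D²V⁺ = λ′ = snd ∘ σ′`, the graph
formula with the Lagrangian form), and this lineage's `…TransportedFormCoercivity` (TFC: kernel coercivity survives the transport).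

WHY.  Bałaban's averaging constraint is nonlinear in the field ([B8] CMP 98 (134)–(135), [B12] CMP 109 (0.17)); the hard step's
critical points on a fibre `{G = w}` are the KKT pairs.  The KKT chain was typed letter by letter (ALE, KCD, HKB, KCDM by leaf-03;
HKAH by leaf-04), each junction certified by a NOT-TO-FILE concat.  THIS FILE is the junction IN THE TREE, the KKT twin of HSIS:
ONE theorem whose hypotheses are the scale-`k` letters at a KKT base pair and whose conclusions are the letters the next scale reads
— the branch block (a), the first-order block (b) (the next gradient IS the multiplier: `DV⁺(w) = λ(w)`, so its size is the dual
size letter `Λ` and its modulus the branch's Lipschitz constant), the Hessian block (c) (`D²V⁺(w) = snd ∘ σ′(w)`, size `≤ K₁`,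
modulus `K₁²·(2e₁ + M₃ + Λe₂ + C₂)·K₁`, and the graph formula `D²V⁺(w) k k′ = (D²V − λ(w) ∘ D²G)(δ w)(δ′k)(δ′k′)`), and (d)
`DV⁺(w₀) = λ₀` — so a VACUUM-CENTRED tower (`λ₀ = 0`: the base point is an unconstrained critical point, `DV(δ₀) = 0`) re-enters with
FULL criticality `DV⁺(w₀) = 0`.  §3 transports the next scale's kernel coercivity: at `w₀` the next Hessian is the Lagrangian form
`𝓛₀` composed with the section `S₀ = fst ∘ σ′(w₀)` of `T` (graph formula + `T ∘ S₀ = 1`), so TFC's two-scale letter for `𝓛₀` gives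
`(m₂∕d²)`-coercivity of `D²V⁺(w₀)` on `ker T⁺` for ANY next linearised constraint `T⁺` — AHE∕ALE's `hco` at scale `k + 1`.

WHAT IS PROVED (assembly; `K₁ := (N′⁻¹ − c)⁻¹`, `ρ′ := (N′⁻¹ − c)·r`, `Mod := 2e₁ + M₃ + Λe₂ + C₂`; the KKT map
`Φ(δ, λ) = (G δ, DV(δ) − λ ∘ DG(δ))` is HKB's with `L := fderiv ℝ V`, `L′ := V″`).
* §1 `residual_zero_of_kkt` (a KKT base pair has zero residual, so HKB's frozen residual reads `DV(δ(w)) = λ(w) ∘ DG(δ(w))` along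
  the branch), `norm_snd_comp_le` (`‖snd ∘ S‖ ≤ ‖S‖`), `norm_snd_comp_sub_le`, **`lagrangian_orth_of_kktDeriv_eq`** (KCD's KKT derivative maps
  `p` to `(k, 0)` ⟹ `G′δ p.1 = k` and the Lagrangian form on `p.1` kills `ker G′δ` — the KKT twin of TSLC `section_letters_of_augEquiv`).
* §2 **`kktInductiveStep`** — INPUT: `E` complete inner-product nontrivial, `F` normed; base pair `x₀ = (δ₀, λ₀)` with
  `fderiv V δ₀ = λ₀ ∘ G′δ₀`; right inverse `N` of `G′δ₀`; the Lagrangian form `𝓛₀ = V″δ₀ − compL λ₀ ∘ G″δ₀` (READING hypothesis) with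
  kernel coercivity `m > 0` on `ker G′δ₀` and ALE's constant `≤ N′`; `c < N′⁻¹`; `0 < r`; on the primal–dual ball `closedBall x₀ r`:
  `HasFDerivAt G (G′x.1) x.1`, `HasFDerivAt G′ (G″x.1) x.1`, `DifferentiableAt V x.1`, `HasFDerivAt (fderiv V) (V″x.1) x.1`, the
  smallness moduli `a, b, e` and sizes `Λ, ρ` with `2a + b + Λe + ρ‖G″δ₀‖ ≤ c`, the Lipschitz letters `e₁, M₃, e₂ ≥ 0` of `G′, V″, G″`
  and the size `‖G″x.1‖ ≤ C₂`.  OUTPUT: `∃ σ : F → E × (F →L ℝ)`, `σ (G δ₀) = x₀`, and on `ball (G δ₀) ρ′`: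
  (a) `σ w ∈ closedBall x₀ r`, `G (σ w).1 = w`, the KKT identity `fderiv V (σ w).1 = (σ w).2 ∘ G′(σ w).1`, `σ` differentiable,
  `‖σ′(w)‖ ≤ K₁`, the section identity `G′(σ w).1 ((σ′(w) k).1) = k`, and the ORTHOGONALITY letter «the moving Lagrangian form
  `V″(δ w) − λ(w) ∘ G″(δ w)` applied to a graph direction `(σ′(w)k).1` kills `ker G′(δ w)`» (TSLC's first letter); (a′) `‖σ w − σ w′‖ ≤ K₁‖w − w′‖`,
  `‖σ′(w) − σ′(w′)‖ ≤ K₁²·Mod·K₁·‖w − w′‖`; (b) `HasFDerivAt (V ∘ (σ ·).1) (σ w).2 w`, `‖(σ w).2‖ ≤ Λ`; (b′)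
  `‖(σ w).2 − (σ w′).2‖ ≤ K₁‖w − w′‖`; (c) `HasFDerivAt (fderiv (V ∘ (σ ·).1)) (snd ∘ σ′(w)) w`, `‖snd ∘ σ′(w)‖ ≤ K₁`, the graph
  formula; (c′) `‖D²V⁺(w) − D²V⁺(w′)‖ ≤ K₁²·Mod·K₁·‖w − w′‖`; (d) `fderiv (V ∘ (σ ·).1) (G δ₀) = λ₀`.
* §3 **`nextKerCoercive_of_twoScale`** — letters in (the step's conclusions AT `w₀`: the graph formula with `𝓛₀` and a section `S₀` of
  `T`), TFC BY NAME: a two-scale letter `∀ v, T⁺ (T v) = 0 → m₂‖v‖² ≤ 𝓛₀ v v` and `‖T v‖ ≤ d‖v‖` (`0 < d`, `0 ≤ m₂`) give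
  `∀ k, T⁺ k = 0 → (m₂∕d²)‖k‖² ≤ D²V⁺(w₀) k k`; **`kktInductiveStep_nextKerCoercive`** — the same read directly on §2's output.
* §4 toy (`example`, NON-VACUITY of §2's letter list): `E = F = ℝ`, `G = id`, `V t = t²∕2`, base pair `x₀ = 0`, `N = 1`, `𝓛₀ = mul`,
  `m = 1`, all moduli ∕ Lipschitz letters `0`, `Λ = ρ = r = 1`, `c = 0`, `N′ =` ALE's constant: §2 fires (`σ 0 = 0`, `D(V ∘ δ)(0) = 0`).

NOT HERE (honest): the next margin `c⁺ < (N⁺)⁻¹`, the rescaling and the choice of `r⁺` (leaf-06's HSRL ∕ HSTT ∕ HSTB are the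
linear-constraint files; their KKT use is a later assembly); the next constraint `G⁺` itself and its letters; symmetry of `D²V⁺`;
the identification of `V ∘ δ` with the fibre minimum (minimality — CVL ∕ CMRW, convex case); `m₂, d` BY VALUE and which `V, G, δ₀`
are Bałaban's ((A3) ∕ (A1c), NC-NE7b-α UNRULED); anything of Bałaban's.  BY-NAME EFFECT ON THE WALL: NONE.  NE7b NOT PRINTED ∕ NOT
PROVED; spine PROVED 0∕9; rung (B)+1 on a FINITE torus — NOT infinite volume, NOT the mass gap, NOT Clay.  HONEST DEPENDENCY: continuum
YM on T⁴ ⇐ BetaPertH ∧ nine spine estimates (0/9 proved); BetaPertH ⇐ (D1) ∧ (D4) ∧ CAP+tail; G-an2-4 gates asym, D1 and NE2∕3∕4.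
-/

set_option autoImplicit false

noncomputable section

namespace Summit.QuantumFields.BalabanUV.T4Continuum.NE7b.HardStepKKTInductiveStep

open Set Filter Topology Function Metric
open scoped NNReal
open Summit.QuantumFields.BalabanUV.T4Continuum.NE7b

variable {E F : Type*} [NormedAddCommGroup E] [InnerProductSpace ℝ E] [CompleteSpace E] [Nontrivial E]
  [NormedAddCommGroup F] [NormedSpace ℝ F]

/-! ## §1. Small letters: the frozen residual at a KKT base pair, and the dual block row of the branch derivative -/

omit [InnerProductSpace ℝ E] [CompleteSpace E] [Nontrivial E] in
/-- A KKT base pair has ZERO residual, so HKB's frozen-residual conclusion `(Φ(σ w)).2 = (Φ x₀).2` reads as the KKT identity along the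
branch: `fderiv V (σ w).1 = (σ w).2 ∘ G′(σ w).1`. [folklore] -/
theorem residual_zero_of_kkt [NormedSpace ℝ E] {V : E → ℝ} {G' : E → E →L[ℝ] F} {x₀ y : E × (F →L[ℝ] ℝ)}
    (hkkt : fderiv ℝ V x₀.1 = x₀.2.comp (G' x₀.1))
    (h : fderiv ℝ V y.1 - y.2.comp (G' y.1) = fderiv ℝ V x₀.1 - x₀.2.comp (G' x₀.1)) :
    fderiv ℝ V y.1 = y.2.comp (G' y.1) := by
  rw [hkkt, sub_self] at h
  exact sub_eq_zero.1 h

omit [InnerProductSpace ℝ E] [CompleteSpace E] [Nontrivial E] in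
/-- `‖snd ∘ S‖ ≤ ‖S‖` (the dual block row of a map into `E × (F →L ℝ)`, sup norm). [folklore] -/
theorem norm_snd_comp_le [NormedSpace ℝ E] (S : F →L[ℝ] E × (F →L[ℝ] ℝ)) :
    ‖(ContinuousLinearMap.snd ℝ E (F →L[ℝ] ℝ)).comp S‖ ≤ ‖S‖ :=
  (ContinuousLinearMap.opNorm_comp_le _ _).trans
    (mul_le_of_le_one_left (norm_nonneg S) (ContinuousLinearMap.norm_snd_le ℝ E (F →L[ℝ] ℝ)))

omit [InnerProductSpace ℝ E] [CompleteSpace E] [Nontrivial E] in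
/-- `‖snd ∘ S − snd ∘ S′‖ ≤ ‖S − S′‖`. [folklore] -/
theorem norm_snd_comp_sub_le [NormedSpace ℝ E] (S S' : F →L[ℝ] E × (F →L[ℝ] ℝ)) :
    ‖(ContinuousLinearMap.snd ℝ E (F →L[ℝ] ℝ)).comp S - (ContinuousLinearMap.snd ℝ E (F →L[ℝ] ℝ)).comp S'‖ ≤ ‖S - S'‖ := by
  rw [← ContinuousLinearMap.comp_sub]
  exact norm_snd_comp_le (S - S')

omit [InnerProductSpace ℝ E] [CompleteSpace E] [Nontrivial E] in
/-- **THE LAGRANGIAN FORM KILLS `ker G′` ON GRAPH DIRECTIONS.**  If KCD's KKT derivative at `(δ, λ)` — the operator reading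
`(h, μ) ↦ (G′δ h, L′δ h − λ ∘ (G″δ h) − μ ∘ G′δ)` — maps `p` to `(k, 0)`, then `G′δ p.1 = k` and `(L′δ − compL λ ∘ G″δ) p.1 κ = 0` for every
`κ ∈ ker G′δ` (the second component says `𝓛 p.1 = p.2 ∘ G′δ`).  With `p = σ′(w) k = A_w⁻¹ (k, 0)` this is the first orthogonality letter of the
critical section that `…TwoScaleLetterConverse` (TSLC) consumes — the KKT twin of its `section_letters_of_augEquiv`. [folklore] -/
theorem lagrangian_orth_of_kktDeriv_eq [NormedSpace ℝ E] (A : E →L[ℝ] F) (P : E →L[ℝ] E →L[ℝ] ℝ) (C : E →L[ℝ] E →L[ℝ] F)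
    (lam : F →L[ℝ] ℝ) (p : E × (F →L[ℝ] ℝ)) (k : F)
    (hp : ((A.comp (ContinuousLinearMap.fst ℝ E (F →L[ℝ] ℝ))).prod
        ((P - ((ContinuousLinearMap.compL ℝ E F ℝ) lam).comp C).comp (ContinuousLinearMap.fst ℝ E (F →L[ℝ] ℝ)) -
          ((ContinuousLinearMap.compL ℝ E F ℝ).flip A).comp (ContinuousLinearMap.snd ℝ E (F →L[ℝ] ℝ)))) p = (k, 0)) :
    A p.1 = k ∧ ∀ κ, A κ = 0 → (P - ((ContinuousLinearMap.compL ℝ E F ℝ) lam).comp C) p.1 κ = 0 := by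
  obtain ⟨h, μ⟩ := p
  rw [KKTChartDerivative.kktDeriv_apply, Prod.mk.injEq] at hp
  obtain ⟨h1, h2⟩ := hp
  refine ⟨h1, fun κ hκ => ?_⟩
  have e : (P - ((ContinuousLinearMap.compL ℝ E F ℝ) lam).comp C) h = P h - lam.comp (C h) := rfl
  rw [e, sub_eq_zero.1 h2, ContinuousLinearMap.comp_apply, hκ, map_zero]

/-! ## §2. THE KKT INDUCTIVE STEP -/

/-- **ONE INDUCTIVE STEP OF THE KKT HARD-STEP ROAD, EVERY PARENT BY NAME (HKB → KCDM → HKAH).**  See the module docstring for the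
letter list; `K₁ = (N′⁻¹ − c)⁻¹`, `ρ′ = (N′⁻¹ − c)·r`, `Mod = 2e₁ + M₃ + Λe₂ + C₂`. [folklore] -/
theorem kktInductiveStep
    {G : E → F} {G' : E → E →L[ℝ] F} {G'' : E → E →L[ℝ] E →L[ℝ] F} {V : E → ℝ} {V'' : E → E →L[ℝ] E →L[ℝ] ℝ}
    {x₀ : E × (F →L[ℝ] ℝ)} (hkkt : fderiv ℝ V x₀.1 = x₀.2.comp (G' x₀.1))
    {N : F →L[ℝ] E} (hN : ∀ w, G' x₀.1 (N w) = w)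
    {𝓛₀ : E →L[ℝ] E →L[ℝ] ℝ} (h𝓛 : 𝓛₀ = V'' x₀.1 - ((ContinuousLinearMap.compL ℝ E F ℝ) x₀.2).comp (G'' x₀.1))
    {m : ℝ} (hm : 0 < m) (hco : ∀ κ, G' x₀.1 κ = 0 → m * ‖κ‖ ^ 2 ≤ 𝓛₀ κ κ)
    {N' c : ℝ≥0} (hN' : ((1 + ‖𝓛₀‖ / m) * ‖N‖ + m⁻¹) + ‖N‖ * (‖𝓛₀‖ * ((1 + ‖𝓛₀‖ / m) * ‖N‖ + m⁻¹) + 1) ≤ (N' : ℝ))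
    (hc : c < N'⁻¹) {r : ℝ} (hr : 0 < r) {a b e Λ ρ : ℝ}
    (hG : ∀ x ∈ closedBall x₀ r, HasFDerivAt G (G' x.1) x.1) (hG' : ∀ x ∈ closedBall x₀ r, HasFDerivAt G' (G'' x.1) x.1)
    (hVd : ∀ x ∈ closedBall x₀ r, DifferentiableAt ℝ V x.1)
    (hV : ∀ x ∈ closedBall x₀ r, HasFDerivAt (fderiv ℝ V) (V'' x.1) x.1)
    (ha : ∀ x ∈ closedBall x₀ r, ‖G' x.1 - G' x₀.1‖ ≤ a) (hb : ∀ x ∈ closedBall x₀ r, ‖V'' x.1 - V'' x₀.1‖ ≤ b)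
    (he : ∀ x ∈ closedBall x₀ r, ‖G'' x.1 - G'' x₀.1‖ ≤ e) (hΛ : ∀ x ∈ closedBall x₀ r, ‖x.2‖ ≤ Λ)
    (hρ : ∀ x ∈ closedBall x₀ r, ‖x.2 - x₀.2‖ ≤ ρ) (hcdef : 2 * a + b + Λ * e + ρ * ‖G'' x₀.1‖ ≤ (c : ℝ))
    {e₁ M₃ e₂ C₂ : ℝ} (he₁ : 0 ≤ e₁) (hM₃ : 0 ≤ M₃) (he₂ : 0 ≤ e₂)
    (hlipG' : ∀ x ∈ closedBall x₀ r, ∀ x' ∈ closedBall x₀ r, ‖G' x.1 - G' x'.1‖ ≤ e₁ * ‖x.1 - x'.1‖)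
    (hlipV'' : ∀ x ∈ closedBall x₀ r, ∀ x' ∈ closedBall x₀ r, ‖V'' x.1 - V'' x'.1‖ ≤ M₃ * ‖x.1 - x'.1‖)
    (hlipG'' : ∀ x ∈ closedBall x₀ r, ∀ x' ∈ closedBall x₀ r, ‖G'' x.1 - G'' x'.1‖ ≤ e₂ * ‖x.1 - x'.1‖)
    (hC₂ : ∀ x ∈ closedBall x₀ r, ‖G'' x.1‖ ≤ C₂) :
    ∃ σ : F → E × (F →L[ℝ] ℝ), σ (G x₀.1) = x₀ ∧
      -- (a) the branch letters
      (∀ w ∈ ball (G x₀.1) (((N' : ℝ)⁻¹ - c) * r),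
        σ w ∈ closedBall x₀ r ∧ G (σ w).1 = w ∧ fderiv ℝ V (σ w).1 = (σ w).2.comp (G' (σ w).1) ∧
        DifferentiableAt ℝ σ w ∧ ‖fderiv ℝ σ w‖ ≤ ((N' : ℝ)⁻¹ - c)⁻¹ ∧
        (∀ k, G' (σ w).1 ((fderiv ℝ σ w k).1) = k) ∧
        ∀ k κ, G' (σ w).1 κ = 0 →
          (V'' (σ w).1 - ((ContinuousLinearMap.compL ℝ E F ℝ) (σ w).2).comp (G'' (σ w).1)) ((fderiv ℝ σ w k).1) κ = 0) ∧
      -- (a′) the branch moduli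
      (∀ w ∈ ball (G x₀.1) (((N' : ℝ)⁻¹ - c) * r), ∀ w' ∈ ball (G x₀.1) (((N' : ℝ)⁻¹ - c) * r),
        ‖σ w - σ w'‖ ≤ ((N' : ℝ)⁻¹ - c)⁻¹ * ‖w - w'‖ ∧
        ‖fderiv ℝ σ w - fderiv ℝ σ w'‖ ≤
          (((N' : ℝ)⁻¹ - c)⁻¹) ^ 2 * (2 * e₁ + M₃ + Λ * e₂ + C₂) * ((N' : ℝ)⁻¹ - c)⁻¹ * ‖w - w'‖) ∧
      -- (b) the first-order letters of `V⁺ = V ∘ δ`: the multiplier is the gradient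
      (∀ w ∈ ball (G x₀.1) (((N' : ℝ)⁻¹ - c) * r),
        HasFDerivAt (V ∘ fun w' => (σ w').1) (σ w).2 w ∧ ‖(σ w).2‖ ≤ Λ) ∧
      (∀ w ∈ ball (G x₀.1) (((N' : ℝ)⁻¹ - c) * r), ∀ w' ∈ ball (G x₀.1) (((N' : ℝ)⁻¹ - c) * r),
        ‖(σ w).2 - (σ w').2‖ ≤ ((N' : ℝ)⁻¹ - c)⁻¹ * ‖w - w'‖) ∧
      -- (c) the Hessian letters of `V⁺`
      (∀ w ∈ ball (G x₀.1) (((N' : ℝ)⁻¹ - c) * r),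
        HasFDerivAt (fderiv ℝ (V ∘ fun w' => (σ w').1))
            ((ContinuousLinearMap.snd ℝ E (F →L[ℝ] ℝ)).comp (fderiv ℝ σ w)) w ∧
        ‖(ContinuousLinearMap.snd ℝ E (F →L[ℝ] ℝ)).comp (fderiv ℝ σ w)‖ ≤ ((N' : ℝ)⁻¹ - c)⁻¹ ∧
        ∀ k k' : F, fderiv ℝ (fderiv ℝ (V ∘ fun w' => (σ w').1)) w k k' =
          (V'' (σ w).1 - ((ContinuousLinearMap.compL ℝ E F ℝ) (σ w).2).comp (G'' (σ w).1))
            ((fderiv ℝ σ w k).1) ((fderiv ℝ σ w k').1)) ∧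
      (∀ w ∈ ball (G x₀.1) (((N' : ℝ)⁻¹ - c) * r), ∀ w' ∈ ball (G x₀.1) (((N' : ℝ)⁻¹ - c) * r),
        ‖fderiv ℝ (fderiv ℝ (V ∘ fun w' => (σ w').1)) w - fderiv ℝ (fderiv ℝ (V ∘ fun w' => (σ w').1)) w'‖ ≤
          (((N' : ℝ)⁻¹ - c)⁻¹) ^ 2 * (2 * e₁ + M₃ + Λ * e₂ + C₂) * ((N' : ℝ)⁻¹ - c)⁻¹ * ‖w - w'‖) ∧
      -- (d) the next gradient at the next centre is the base multiplier (`= 0` for a vacuum-centred tower)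
      fderiv ℝ (V ∘ fun w' => (σ w').1) (G x₀.1) = x₀.2 := by
  subst h𝓛
  -- HKB: the KKT branch with its derivative letters (L := fderiv V, L′ := V″)
  obtain ⟨σ, hσ0, hσ, hlip, hσ'⟩ := HardStepKKTBranch.exists_kktBranch_hasFDerivAt (G := G) (G' := G') (G'' := G'')
    (L := fderiv ℝ V) (L' := V'') hN hm hco hN' hc hr.le hG hG' hV ha hb he hΛ hρ hcdef
  have hc' : (c : ℝ) < (N' : ℝ)⁻¹ := by
    have h := NNReal.coe_lt_coe.2 hc
    rwa [NNReal.coe_inv] at h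
  have hpos : (0 : ℝ) < (N' : ℝ)⁻¹ - c := sub_pos.2 hc'
  have hK0 : (0 : ℝ) ≤ ((N' : ℝ)⁻¹ - c)⁻¹ := inv_nonneg.2 hpos.le
  have hcoe : (((N'⁻¹ - c)⁻¹ : ℝ≥0) : ℝ) = ((N' : ℝ)⁻¹ - c)⁻¹ := by
    rw [NNReal.coe_inv, NNReal.coe_sub hc.le, NNReal.coe_inv]
  have hρ' : 0 < ((N' : ℝ)⁻¹ - c) * r := mul_pos hpos hr
  -- the letters on the open ball, in clean shapes
  have hmem : ∀ w ∈ ball (G x₀.1) (((N' : ℝ)⁻¹ - c) * r), σ w ∈ closedBall x₀ r := fun w hw =>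
    (hσ w (ball_subset_closedBall hw)).1
  have hGσ : ∀ w ∈ ball (G x₀.1) (((N' : ℝ)⁻¹ - c) * r), G (σ w).1 = w := fun w hw =>
    (hσ w (ball_subset_closedBall hw)).2.1
  have hres : ∀ w ∈ ball (G x₀.1) (((N' : ℝ)⁻¹ - c) * r), fderiv ℝ V (σ w).1 = (σ w).2.comp (G' (σ w).1) :=
    fun w hw => residual_zero_of_kkt hkkt (hσ w (ball_subset_closedBall hw)).2.2
  have hder : ∀ w ∈ ball (G x₀.1) (((N' : ℝ)⁻¹ - c) * r), HasFDerivAt σ (fderiv ℝ σ w) w ∧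
      ‖fderiv ℝ σ w‖ ≤ ((N' : ℝ)⁻¹ - c)⁻¹ := fun w hw => by
    obtain ⟨A, -, -, h3, h4⟩ := hσ' w hw
    exact ⟨h3.differentiableAt.hasFDerivAt, by rw [h3.fderiv]; exact h4⟩
  have hGat : ∀ w ∈ ball (G x₀.1) (((N' : ℝ)⁻¹ - c) * r), HasFDerivAt G (G' (σ w).1) (σ w).1 := fun w hw =>
    hG (σ w) (hmem w hw)
  have hVat : ∀ w ∈ ball (G x₀.1) (((N' : ℝ)⁻¹ - c) * r), DifferentiableAt ℝ V (σ w).1 := fun w hw =>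
    hVd (σ w) (hmem w hw)
  have hσLip : ∀ w ∈ ball (G x₀.1) (((N' : ℝ)⁻¹ - c) * r), ∀ w' ∈ ball (G x₀.1) (((N' : ℝ)⁻¹ - c) * r),
      ‖σ w - σ w'‖ ≤ ((N' : ℝ)⁻¹ - c)⁻¹ * ‖w - w'‖ := fun w hw w' hw' => by
    have h := hlip.norm_sub_le (ball_subset_closedBall hw) (ball_subset_closedBall hw')
    rwa [hcoe] at h
  -- KCDM: the modulus of σ′ (HKB's letters in, verbatim)
  have hmod := KKTChartDerivativeModulus.norm_fderiv_kktBranch_sub_le (L := fderiv ℝ V) (L' := V'') he₁ hM₃ he₂ hG hG' hV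
    hlipG' hlipV'' hlipG'' hΛ hC₂ hc hσ hlip hσ'
  -- HKAH §1: the section identity along the branch
  have hsec : ∀ w ∈ ball (G x₀.1) (((N' : ℝ)⁻¹ - c) * r), ∀ k, G' (σ w).1 ((fderiv ℝ σ w k).1) = k := fun w hw k => by
    have hδ : HasFDerivAt (fun w' => (σ w').1) ((ContinuousLinearMap.fst ℝ E (F →L[ℝ] ℝ)).comp (fderiv ℝ σ w)) w :=
      (ContinuousLinearMap.fst ℝ E (F →L[ℝ] ℝ)).hasFDerivAt.comp w (hder w hw).1
    exact HardStepKKTActionHessian.apply_branchDeriv (G := G) (δ := fun w' => (σ w').1) (isOpen_ball.mem_nhds hw) hGσ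
      (hGat w hw) hδ k
  -- HKAH §6: the value side along the branch
  have hval : ∀ w ∈ ball (G x₀.1) (((N' : ℝ)⁻¹ - c) * r),
      HasFDerivAt (V ∘ fun w' => (σ w').1) (σ w).2 w ∧
        HasFDerivAt (fderiv ℝ (V ∘ fun w' => (σ w').1))
          ((ContinuousLinearMap.snd ℝ E (F →L[ℝ] ℝ)).comp (fderiv ℝ σ w)) w := fun w hw =>
    HardStepKKTActionHessian.hasFDerivAt_fderiv_value_of_kktBranch (Gd := G') (S := fun w' => fderiv ℝ σ w') hGσ hres
      (fun w' hw' => (hder w' hw').1) hGat hVat hw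
  -- KCD's reading of A_w = DΦ(σ w): the moving Lagrangian form kills ker G′(σ w) on graph directions (TSLC's first letter)
  have horth : ∀ w ∈ ball (G x₀.1) (((N' : ℝ)⁻¹ - c) * r), ∀ k κ, G' (σ w).1 κ = 0 →
      (V'' (σ w).1 - ((ContinuousLinearMap.compL ℝ E F ℝ) (σ w).2).comp (G'' (σ w).1)) ((fderiv ℝ σ w k).1) κ = 0 :=
    fun w hw k κ hκ => by
    obtain ⟨A, hAeq, -, h3, -⟩ := hσ' w hw
    have hfd : fderiv ℝ σ w k = A.symm (k, 0) := by rw [h3.fderiv]; rfl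
    have hAk : (A : (E × (F →L[ℝ] ℝ)) →L[ℝ] (F × (E →L[ℝ] ℝ))) (A.symm (k, 0)) = (k, 0) := A.apply_symm_apply (k, 0)
    have hD := KKTChartDerivative.fderiv_kktMap (lam := (σ w).2) (hGat w hw) (hG' (σ w) (hmem w hw)) (hV (σ w) (hmem w hw))
    rw [Prod.mk.eta] at hD
    rw [hAeq, hD] at hAk
    rw [hfd]
    exact (lagrangian_orth_of_kktDeriv_eq _ _ _ _ _ k hAk).2 κ hκ
  refine ⟨σ, hσ0, ?_, ?_, ?_, ?_, ?_, ?_, ?_⟩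
  -- (a)
  · intro w hw
    exact ⟨hmem w hw, hGσ w hw, hres w hw, (hder w hw).1.differentiableAt, (hder w hw).2, hsec w hw, horth w hw⟩
  -- (a′)
  · intro w hw w' hw'
    exact ⟨hσLip w hw w' hw', hmod w hw w' hw'⟩
  -- (b)
  · intro w hw
    exact ⟨(hval w hw).1, hΛ (σ w) (hmem w hw)⟩
  -- (b′)
  · intro w hw w' hw'
    have h : ‖(σ w).2 - (σ w').2‖ ≤ ‖σ w - σ w'‖ := by simpa using norm_snd_le (σ w - σ w')
    exact h.trans (hσLip w hw w' hw')
  -- (c)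
  · intro w hw
    refine ⟨(hval w hw).2, (norm_snd_comp_le _).trans (hder w hw).2, fun k k' => ?_⟩
    exact HardStepKKTActionHessian.hessian_value_of_kktBranch_apply (Gd := G') (S := fun w' => fderiv ℝ σ w') hGσ hres
      (fun w' hw' => (hder w' hw').1) hGat hVat hw (hV (σ w) (hmem w hw)) (hG' (σ w) (hmem w hw)) k k'
  -- (c′)
  · intro w hw w' hw'
    rw [(hval w hw).2.fderiv, (hval w' hw').2.fderiv]
    exact (norm_snd_comp_sub_le _ _).trans (hmod w hw w' hw')
  -- (d)
  · have h := (hval (G x₀.1) (mem_ball_self hρ')).1.fderiv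
    rw [h, hσ0]

/-! ## §3. The next kernel coercivity (TFC by name) -/

omit [CompleteSpace E] [Nontrivial E] in
/-- **THE NEXT SCALE's KERNEL COERCIVITY FROM A TWO-SCALE LETTER**, letters in: at the next centre `w₀` the next Hessian reads the
Lagrangian form through a section `S₀` of `T` (`∀ k k′, Q⁺ k k′ = 𝓛₀ (S₀ k) (S₀ k′)`, `T (S₀ k) = k` — §2 (c) and (a) at `w₀`), the
two-scale letter `T⁺ (T v) = 0 → m₂‖v‖² ≤ 𝓛₀ v v` and the size `‖T v‖ ≤ d‖v‖` (`0 < d`, `0 ≤ m₂`) ⟹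
`T⁺ k = 0 → (m₂∕d²)‖k‖² ≤ Q⁺ k k` (TFC `kerCoercive_bilinearComp_div` + `bilinearComp_apply'`). [folklore] -/
theorem nextKerCoercive_of_twoScale {F' : Type*} [NormedAddCommGroup F'] [NormedSpace ℝ F']
    {𝓛₀ : E →L[ℝ] E →L[ℝ] ℝ} {T : E →L[ℝ] F} {S₀ : F →L[ℝ] E} {Qn : F →L[ℝ] F →L[ℝ] ℝ}
    (hS₀ : ∀ k, T (S₀ k) = k) (hQn : ∀ k k', Qn k k' = 𝓛₀ (S₀ k) (S₀ k'))
    (Tn : F →L[ℝ] F') {m₂ : ℝ} (hm₂ : 0 ≤ m₂) (hco₂ : ∀ v, Tn (T v) = 0 → m₂ * ‖v‖ ^ 2 ≤ 𝓛₀ v v)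
    {d : ℝ} (hd0 : 0 < d) (hd : ∀ v, ‖T v‖ ≤ d * ‖v‖) :
    ∀ k, Tn k = 0 → m₂ / d ^ 2 * ‖k‖ ^ 2 ≤ Qn k k := by
  intro k hk
  rw [hQn, ← TransportedFormCoercivity.bilinearComp_apply' 𝓛₀ S₀ S₀ k k]
  exact TransportedFormCoercivity.kerCoercive_bilinearComp_div hS₀ Tn hm₂ hco₂ hd0 hd k hk

omit [CompleteSpace E] [Nontrivial E] in
/-- **THE SAME ON §2's OUTPUT SHAPE**: with `σ (G δ₀) = x₀`, the section identity and the graph formula at `w₀ = G δ₀` (§2 (a), (c)),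
the Lagrangian form read as `𝓛₀ = V″δ₀ − compL λ₀ ∘ G″δ₀`, a two-scale letter for `𝓛₀` and the size of `T = G′δ₀`:
`∀ k, T⁺ k = 0 → (m₂∕d²)‖k‖² ≤ D²V⁺(w₀) k k` — AHE ∕ ALE's `hco` at scale `k + 1` for the next action `V⁺ = V ∘ (σ ·).1`. [folklore] -/
theorem kktInductiveStep_nextKerCoercive {F' : Type*} [NormedAddCommGroup F'] [NormedSpace ℝ F']
    {G : E → F} {G' : E → E →L[ℝ] F} {G'' : E → E →L[ℝ] E →L[ℝ] F} {V : E → ℝ} {V'' : E → E →L[ℝ] E →L[ℝ] ℝ}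
    {x₀ : E × (F →L[ℝ] ℝ)} {σ : F → E × (F →L[ℝ] ℝ)} (hσ0 : σ (G x₀.1) = x₀)
    (hsec : ∀ k, G' (σ (G x₀.1)).1 ((fderiv ℝ σ (G x₀.1) k).1) = k)
    (hgraph : ∀ k k' : F, fderiv ℝ (fderiv ℝ (V ∘ fun w' => (σ w').1)) (G x₀.1) k k' =
      (V'' (σ (G x₀.1)).1 - ((ContinuousLinearMap.compL ℝ E F ℝ) (σ (G x₀.1)).2).comp (G'' (σ (G x₀.1)).1))
        ((fderiv ℝ σ (G x₀.1) k).1) ((fderiv ℝ σ (G x₀.1) k').1))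
    {𝓛₀ : E →L[ℝ] E →L[ℝ] ℝ} (h𝓛 : 𝓛₀ = V'' x₀.1 - ((ContinuousLinearMap.compL ℝ E F ℝ) x₀.2).comp (G'' x₀.1))
    (Tn : F →L[ℝ] F') {m₂ : ℝ} (hm₂ : 0 ≤ m₂) (hco₂ : ∀ v, Tn (G' x₀.1 v) = 0 → m₂ * ‖v‖ ^ 2 ≤ 𝓛₀ v v)
    {d : ℝ} (hd0 : 0 < d) (hd : ∀ v, ‖G' x₀.1 v‖ ≤ d * ‖v‖) :
    ∀ k, Tn k = 0 → m₂ / d ^ 2 * ‖k‖ ^ 2 ≤ fderiv ℝ (fderiv ℝ (V ∘ fun w' => (σ w').1)) (G x₀.1) k k := by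
  subst h𝓛
  rw [hσ0] at hsec hgraph
  refine nextKerCoercive_of_twoScale (𝓛₀ := V'' x₀.1 - ((ContinuousLinearMap.compL ℝ E F ℝ) x₀.2).comp (G'' x₀.1))
    (T := G' x₀.1) (S₀ := (ContinuousLinearMap.fst ℝ E (F →L[ℝ] ℝ)).comp (fderiv ℝ σ (G x₀.1)))
    (fun k => hsec k) (fun k k' => ?_) Tn hm₂ hco₂ hd0 hd
  exact hgraph k k'

/-! ## §4. Toy: the letter list of §2 is jointly satisfiable -/

section Toy

/-- Toy letter: `t ↦ t²∕2` has Fréchet derivative `mul y` at `y`. -/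
private theorem hasFDerivAt_half_sq (y : ℝ) :
    HasFDerivAt (fun t : ℝ => t * t / 2) (ContinuousLinearMap.mul ℝ ℝ y) y :=
  ((((hasDerivAt_id y).mul (hasDerivAt_id y)).div_const 2).congr_deriv (by simp only [id]; ring)).hasFDerivAt.congr_fderiv
    (by ext; simp [mul_comm])

/-- Toy letter: `fderiv (t ↦ t²∕2) = mul`. -/
private theorem fderiv_half_sq : fderiv ℝ (fun t : ℝ => t * t / 2) = fun y => ContinuousLinearMap.mul ℝ ℝ y :=
  funext fun y => (hasFDerivAt_half_sq y).fderiv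

omit [CompleteSpace E] [Nontrivial E] in
/-- Toy letter (generic, see the engineering note of v1.1): a constant field has Lipschitz letter `0`. -/
private theorem toy_sub_self_le₁ (A : E →L[ℝ] F) (t : ℝ) : ‖A - A‖ ≤ 0 * t := by
  rw [sub_self, zero_mul, ContinuousLinearMap.opNorm_zero]

omit [CompleteSpace E] [Nontrivial E] in
/-- Toy letter (generic): a constant bilinear field has Lipschitz letter `0`. -/
private theorem toy_sub_self_le₂ (A : E →L[ℝ] E →L[ℝ] F) (t : ℝ) : ‖A - A‖ ≤ 0 * t := by
  rw [sub_self, zero_mul, ContinuousLinearMap.opNorm_zero]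

omit [CompleteSpace E] [Nontrivial E] in
/-- Toy letter (generic): a constant field has smallness modulus `0`. -/
private theorem toy_sub_self_le₁' (A : E →L[ℝ] F) : ‖A - A‖ ≤ 0 := by
  rw [sub_self, ContinuousLinearMap.opNorm_zero]

omit [CompleteSpace E] [Nontrivial E] in
/-- Toy letter (generic): a constant bilinear field has smallness modulus `0`. -/
private theorem toy_sub_self_le₂' (A : E →L[ℝ] E →L[ℝ] F) : ‖A - A‖ ≤ 0 := by
  rw [sub_self, ContinuousLinearMap.opNorm_zero]

omit [CompleteSpace E] [Nontrivial E] in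
/-- Toy letter (generic): the zero bilinear field has size letter `0`. -/
private theorem toy_norm_le_of_eq_zero {A : E →L[ℝ] E →L[ℝ] F} (hA : A = 0) : ‖A‖ ≤ 0 := by
  rw [hA, ContinuousLinearMap.opNorm_zero]

omit [CompleteSpace E] [Nontrivial E] in
/-- Toy letter (generic): the smallness budget `2a + b + Λe + ρ‖G″δ₀‖ ≤ c` at `a = b = e = 0`, `G″δ₀ = 0`, `c = 0`. -/
private theorem toy_budget {A : E →L[ℝ] E →L[ℝ] F} (hA : A = 0) :
    2 * (0 : ℝ) + 0 + 1 * 0 + 1 * ‖A‖ ≤ ((0 : ℝ≥0) : ℝ) := by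
  rw [hA, ContinuousLinearMap.opNorm_zero]; simp

/-- Toy (NON-VACUITY of §2's letter list): `E = F = ℝ`, the identity constraint `G = id` (`G′ ≡ 1`, `G″ ≡ 0`), the action
`V t = t²∕2` (`DV = mul`, `V″ ≡ mul`), the vacuum base pair `x₀ = 0 = (0, 0)`, `N = 1`, `𝓛₀ = mul`, `m = 1`, all moduli and Lipschitz
letters `0`, sizes `Λ = ρ = 1`, `c = 0`, `r = 1`, `N′ =` ALE's constant itself (`Real.toNNReal`): §2 fires, and returns a branch with
`σ 0 = 0` and full criticality `D(V ∘ δ)(0) = 0` ((d) at `λ₀ = 0`). -/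
example : ∃ σ : ℝ → ℝ × (ℝ →L[ℝ] ℝ), σ 0 = 0 ∧ fderiv ℝ ((fun t : ℝ => t * t / 2) ∘ fun w' => (σ w').1) 0 = 0 := by
  have hpos : (0 : ℝ) < ((1 + ‖ContinuousLinearMap.mul ℝ ℝ‖ / 1) * ‖ContinuousLinearMap.id ℝ ℝ‖ + 1⁻¹) +
      ‖ContinuousLinearMap.id ℝ ℝ‖ * (‖ContinuousLinearMap.mul ℝ ℝ‖ * ((1 + ‖ContinuousLinearMap.mul ℝ ℝ‖ / 1) *
        ‖ContinuousLinearMap.id ℝ ℝ‖ + 1⁻¹) + 1) := by positivity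
  obtain ⟨σ, h0, -, -, -, -, -, -, hd⟩ := kktInductiveStep (E := ℝ) (F := ℝ) (G := fun t : ℝ => t)
    (G' := fun _ => ContinuousLinearMap.id ℝ ℝ) (G'' := fun _ => (0 : ℝ →L[ℝ] ℝ →L[ℝ] ℝ)) (V := fun t : ℝ => t * t / 2)
    (V'' := fun _ => ContinuousLinearMap.mul ℝ ℝ) (x₀ := 0) (by rw [fderiv_half_sq]; simp)
    (N := ContinuousLinearMap.id ℝ ℝ) (fun _ => rfl) (𝓛₀ := ContinuousLinearMap.mul ℝ ℝ) (by simp) one_pos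
    (fun κ _ => by rw [ContinuousLinearMap.mul_apply', one_mul, Real.norm_eq_abs, sq_abs, sq])
    (N' := Real.toNNReal _) (c := 0) (Real.le_coe_toNNReal _) (inv_pos.2 (Real.toNNReal_pos.2 hpos)) (r := 1) one_pos
    (a := 0) (b := 0) (e := 0) (Λ := 1) (ρ := 1)
    (fun x _ => hasFDerivAt_id x.1) (fun x _ => hasFDerivAt_const _ x.1)
    (fun x _ => (hasFDerivAt_half_sq x.1).differentiableAt)
    (fun x _ => by rw [fderiv_half_sq]; exact (ContinuousLinearMap.mul ℝ ℝ).hasFDerivAt)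
    (fun x _ => toy_sub_self_le₁' _) (fun x _ => toy_sub_self_le₂' _) (fun x _ => toy_sub_self_le₂' _)
    (fun x hx => (norm_snd_le x).trans (mem_closedBall_zero_iff.1 hx))
    (fun x hx => by simpa using (norm_snd_le x).trans (mem_closedBall_zero_iff.1 hx))
    (toy_budget rfl) (e₁ := 0) (M₃ := 0) (e₂ := 0) (C₂ := 0) le_rfl le_rfl le_rfl
    (fun x _ x' _ => toy_sub_self_le₁ _ _) (fun x _ x' _ => toy_sub_self_le₂ _ _) (fun x _ x' _ => toy_sub_self_le₂ _ _)
    (fun x _ => toy_norm_le_of_eq_zero rfl)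
  exact ⟨σ, h0, hd⟩

end Toy

end Summit.QuantumFields.BalabanUV.T4Continuum.NE7b.HardStepKKTInductiveStep

end
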